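import Literature.NumberTheory.PAdicHodge.TateTraceFixedField
import HarnessLib

/-!
# Tate 1967 §3.2 Prop. 7 on `X = \widehat{K_∞}`: `γ − 1` is onto `ker R_n`, and the `H¹` criterion

Continuation of `TateTraceFixedField`. Notation as there and in `TateInvariantsBase`: `X = \widehat{K_∞} ⊆ ℂ_F`
(closure of `S = K_∞`), `R_n = TateTrace.Rhat n : X → ℂ_F` the extended normalised trace, `γ = gen n`, `n ≥ 2`.
THEOREMS ONLY; no named fact, no `sorry`.

* `TateTrace.Rfun_mem_S`, `Rfun_Rfun`, `Rfun_sub`, `exists_rep_of_Rfun_eq_zero`, `norm_le_of_Rfun_eq_zero` —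
  bookkeeping on `S`: `R_n(S) ⊆ S`, `R_n ∘ R_n = R_n`, and Tate's estimate `‖s‖ ≤ ‖p‖⁻² ‖γ s − s‖` on `ker R_n`.
* `TateTrace.exists_gen_smul_sub_eq_of_Rhat_eq_zero` — **Tate's Prop. 7**: every `a ∈ X` with `R_n a = 0`
  is `γ x − x` for some `x ∈ X` with `R_n x = 0`. Proof: approximants `a_k = s_k − R_n s_k ∈ S ∩ ker R_n`,
  `a_k → a` (continuity of `R_n`); finite-level preimages `z_k` (`TateTraceFixedField`); `(z_k)` is Cauchy
  by the estimate applied to `z_k − z_l ∈ ker R_n`; `ℂ_F` is complete, `X` is closed, `R_n` and `γ` are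
  continuous.
* `TateTrace.eq_zero_of_Rhat_eq_zero_of_gen_smul_eq` — uniqueness: `γ − 1` is injective on `ker R_n`.
* `TateTrace.Rhat_gen_smul_sub_self` — `R_n` kills `γ`-coboundaries of `X`.
* `TateTrace.Rhat_mem_X`, `Rhat_Rhat` — `R_n(X) ⊆ X`, `R_n ∘ R_n = R_n`; `traceToLevel_base_smul`,
  `Rfun_base_smul`, `Rhat_base_smul` — **`R_n` is `G₀`-equivariant** (`G₀` acts on each `K M` through an
  abelian quotient). (The twisted operators `γ − c`, `c ≠ 1`, are treated in `TateTwistCoboundary`.)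
* `TateTrace.exists_gen_smul_sub_eq_iff_Rhat_eq_zero` — **the `H¹` criterion**: for `a ∈ X`,
  `a ∈ (γ − 1)X ⟺ R_n a = 0`; so `X/(γ − 1)X ≅ R_n(X) ⊆ K n` — the `X`-part of Tate's computation
  `H¹(Γ_F, ℂ_F) = F · log χ` (§3.3 Thm. 1). NOT here: the remaining input `H¹(Gal(F̄/K_∞), ℂ_F) = 0`
  (almost-étale descent) and the twisted version `γ − λ`, `λ = χ(γ)^j ≠ 1` (for `H¹(Γ_F, ℂ_F(χ^j)) = 0`).

## References
* J. Tate, *p-divisible groups* (1967), §3.2 Prop. 7–8, §3.3 Theorem 1. [Tate1967]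
* J.-M. Fontaine, Y. Ouyang, *Theory of p-adic Galois representations*, §3.1 Prop. 3.16, §3.2. [FontaineOuyang2022]
-/

noncomputable section

open ValuativeRel Field UniformSpace Filter Topology Finset

open scoped IntermediateField

namespace Literature.NumberTheory.PAdicHodge

open Literature.NumberTheory.GaloisRepresentations
open Literature.NumberTheory.GaloisRepresentations.IsNonarchimedeanLocalField
open CyclotomicTower

variable {F : Type} [Field F] [ValuativeRel F] [TopologicalSpace F] [IsNonarchimedeanLocalField F]
  [CharZero F] {p : ℕ} [Fact p.Prime] (hp : valuation F p < 1)

namespace TateTrace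

/-! ### Tate's Prop. 7 on `X = \widehat{K_∞}`: `γ - 1` maps `ker R_n` ONTO `ker R_n` -/

/-- `R_n s ∈ S` (indeed `R_n s ∈ K n ⊆ K_∞`). [cite: Tate1967, §3.1] -/
theorem Rfun_mem_S {n : ℕ} (hn : 2 ≤ n) (s : S hp) : Rfun hp n s ∈ S hp := by
  obtain ⟨hl, hmem⟩ := lvl_spec hp n s
  exact coe_mem_S hp (K_le_Kinf hp _ (traceToLevel_mem_K hp hn hl hmem))

/-- **`R_n` is idempotent on `S`.** [cite: Tate1967, §3.1] -/
theorem Rfun_Rfun {n : ℕ} (hn : 2 ≤ n) (s : S hp) :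
    Rfun hp n ⟨Rfun hp n s, Rfun_mem_S hp hn s⟩ = Rfun hp n s := by
  obtain ⟨hl, hmem⟩ := lvl_spec hp n s
  have hmemR : traceToLevel hp n (lvl hp n s) (pre hp s) ∈ K hp (lvl hp n s) := by
    rw [traceToLevel_def, avg_def]
    exact IntermediateField.smul_mem _ (sum_mem fun k _ => smul_mem_K hp _ hmem)
  have hy : ((traceToLevel hp n (lvl hp n s) (pre hp s) : NormedAlgClosure F) : CompletedAlgClosure F) =
      Rfun hp n s := rfl
  rw [Rfun_eq hp (by omega) hy hl hmemR, traceToLevel_traceToLevel hp hn hl hmem]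
  rfl

/-- `R_n` commutes with subtraction on `S`. [cite: Tate1967, §3.1] -/
theorem Rfun_sub {n : ℕ} (hn : 1 ≤ n) (s t : S hp) (h : (s : CompletedAlgClosure F) - t ∈ S hp) :
    Rfun hp n ⟨(s : CompletedAlgClosure F) - t, h⟩ = Rfun hp n s - Rfun hp n t := by
  obtain ⟨y, z, M, hy, hz, hM, hyM, hzM⟩ := exists_common_level hp n s t
  have hyz : ((y - z : NormedAlgClosure F) : CompletedAlgClosure F) = (s : CompletedAlgClosure F) - t := by
    rw [Completion.coe_sub, hy, hz]
  rw [Rfun_eq hp hn hyz hM (sub_mem hyM hzM), Rfun_eq hp hn hy hM hyM, Rfun_eq hp hn hz hM hzM,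
    traceToLevel_sub, Completion.coe_sub]

/-- An element of `S` killed by `R_n` is `↑y` for some `y ∈ K M`, `M > n`, with `R_n y = 0` in `K M`. [folklore] -/
private theorem exists_rep_of_Rfun_eq_zero {n : ℕ} (s : S hp) (h0 : Rfun hp n s = 0) :
    ∃ (M : ℕ) (y : NormedAlgClosure F), n + 1 ≤ M ∧ y ∈ K hp M ∧
      (y : CompletedAlgClosure F) = s ∧ traceToLevel hp n M y = 0 := by
  obtain ⟨hl, hmem⟩ := lvl_spec hp n s
  refine ⟨lvl hp n s, pre hp s, hl, hmem, coe_pre hp s, ?_⟩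
  apply Completion.coe_injective (NormedAlgClosure F)
  rw [Completion.coe_zero]
  exact h0

/-- **Tate's estimate on `ker R_n ∩ S`**: `‖s‖ ≤ ‖p‖⁻² ‖γ s − s‖` when `R_n s = 0`. [cite: Tate1967, §3.2 Prop. 7] -/
theorem norm_le_of_Rfun_eq_zero {n : ℕ} (hn : 2 ≤ n) (s : S hp) (h0 : Rfun hp n s = 0) :
    ‖(s : CompletedAlgClosure F)‖ ≤
      ‖(p : PadicBase F p hp)‖⁻¹ ^ 2 * ‖gen hp n • (s : CompletedAlgClosure F) - s‖ := by
  have := norm_sub_Rfun_le hp hn s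
  rwa [h0, sub_zero] at this

/-- **Tate 1967 §3.2 Prop. 7 (surjectivity on the kernel of the normalised trace).** Let `n ≥ 2`,
`γ = gen n`, `X = \widehat{K_∞}`, `R_n = Rhat n`. For every `a ∈ X` with `R_n a = 0` there is `x ∈ X` with
`R_n x = 0` and `γ x − x = a`. (With Tate's estimate `‖x‖ ≤ ‖p‖⁻² ‖γ x − x‖` on `ker R_n`, tree
`norm_sub_Rhat_le`: `γ − 1` is a bicontinuous bijection of `ker R_n`, i.e. `H¹(⟨γ⟩, ker R_n) = 0`.) Proof:
finite level (`exists_gen_smul_sub_eq_of_traceToLevel_eq_zero`) on approximants `a_k = s_k − R_n s_k → a`,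
whose preimages form a Cauchy sequence by the estimate; `ℂ_F` is complete and `X`, `ker R_n` are closed.
[cite: Tate1967, §3.2 Prop. 7] [cite: FontaineOuyang2022, §3.1 Prop. 3.16] -/
theorem exists_gen_smul_sub_eq_of_Rhat_eq_zero {n : ℕ} (hn : 2 ≤ n) {a : CompletedAlgClosure F}
    (ha : a ∈ X hp) (ha0 : Rhat hp n ⟨a, ha⟩ = 0) :
    ∃ (x : CompletedAlgClosure F) (hx : x ∈ X hp), Rhat hp n ⟨x, hx⟩ = 0 ∧ gen hp n • x - x = a := by
  set C : ℝ := ‖(p : PadicBase F p hp)‖⁻¹ ^ 2 with hC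
  have hC0 : 0 ≤ C := pow_nonneg (inv_nonneg.mpr (norm_nonneg _)) 2
  -- (1) approximate `a` by `u k ∈ S`
  obtain ⟨u, huS, hua⟩ := mem_closure_iff_seq_limit.mp ha
  -- (2) `a_k = u k - R_n (u k) ∈ S ∩ ker R_n`, `a_k → a`
  have haS : ∀ k, u k - Rfun hp n ⟨u k, huS k⟩ ∈ S hp := fun k =>
    sub_mem_S hp (huS k) (Rfun_mem_S hp hn ⟨u k, huS k⟩)
  have ha0k : ∀ k, Rfun hp n ⟨u k - Rfun hp n ⟨u k, huS k⟩, haS k⟩ = 0 := by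
    intro k
    rw [Rfun_sub hp (by omega) ⟨u k, huS k⟩ ⟨Rfun hp n ⟨u k, huS k⟩, Rfun_mem_S hp hn ⟨u k, huS k⟩⟩ (haS k),
      Rfun_Rfun hp hn, sub_self]
  have hRu : Tendsto (fun k => Rfun hp n ⟨u k, huS k⟩) atTop (𝓝 0) := by
    have h1 : Tendsto (fun k => incl hp ⟨u k, huS k⟩) atTop (𝓝 (⟨a, ha⟩ : X hp)) := by
      rw [tendsto_subtype_rng]; exact hua
    have h2 := ((continuous_Rhat hp hn).tendsto _).comp h1
    rw [ha0] at h2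
    refine h2.congr fun k => ?_
    simp only [Function.comp_apply, Rhat_incl hp hn]
  have haa : Tendsto (fun k => u k - Rfun hp n ⟨u k, huS k⟩) atTop (𝓝 a) := by
    have := hua.sub hRu
    rwa [sub_zero] at this
  -- (3) finite level: `a_k = ↑y_k`, `y_k = γ z_k - z_k`, `R_n z_k = 0`
  have hrep : ∀ k, ∃ (M : ℕ) (z : NormedAlgClosure F), n + 1 ≤ M ∧ z ∈ K hp M ∧
      traceToLevel hp n M z = 0 ∧
      gen hp n • (z : CompletedAlgClosure F) - z = u k - Rfun hp n ⟨u k, huS k⟩ := by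
    intro k
    obtain ⟨M, y, hM, hyM, hy, hy0⟩ := exists_rep_of_Rfun_eq_zero hp ⟨_, haS k⟩ (ha0k k)
    obtain ⟨z, hzM, hz0, hzy⟩ := exists_gen_smul_sub_eq_of_traceToLevel_eq_zero hp hn hM hyM hy0
    refine ⟨M, z, hM, hzM, hz0, ?_⟩
    rw [CompletedAlgClosure.base_smul_coe, ← Completion.coe_sub, hzy, hy]
  choose Mk z hMk hzK hz0 hzy using hrep
  set x : ℕ → CompletedAlgClosure F := fun k => (z k : CompletedAlgClosure F) with hxdef
  have hxS : ∀ k, x k ∈ S hp := fun k => coe_mem_S hp (K_le_Kinf hp _ (hzK k))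
  -- differences `x k - x l` lie in `S ∩ ker R_n`
  have hdiffS : ∀ k l, x k - x l ∈ S hp := fun k l => sub_mem_S hp (hxS k) (hxS l)
  have hdiff0 : ∀ k l, Rfun hp n ⟨x k - x l, hdiffS k l⟩ = 0 := by
    intro k l
    set M := max (Mk k) (Mk l) with hMdef
    have hyz : (((z k - z l : NormedAlgClosure F)) : CompletedAlgClosure F) = x k - x l := by
      rw [Completion.coe_sub]
    rw [Rfun_eq hp (by omega) hyz (le_trans (hMk k) (le_max_left _ _))
      (sub_mem (K_mono hp (le_max_left _ _) (hzK k)) (K_mono hp (le_max_right _ _) (hzK l))),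
      traceToLevel_sub, traceToLevel_eq_of_mem_K hp (by omega) (hMk k) (le_max_left _ _) (hzK k),
      traceToLevel_eq_of_mem_K hp (by omega) (hMk l) (le_max_right _ _) (hzK l), hz0, hz0, sub_zero,
      Completion.coe_zero]
  -- (4) the Cauchy estimate `‖x k - x l‖ ≤ C ‖a_k - a_l‖`
  have hest : ∀ k l, ‖x k - x l‖ ≤ C * ‖(u k - Rfun hp n ⟨u k, huS k⟩) - (u l - Rfun hp n ⟨u l, huS l⟩)‖ := by
    intro k l
    have h1 := norm_le_of_Rfun_eq_zero hp hn ⟨x k - x l, hdiffS k l⟩ (hdiff0 k l)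
    have h2 : gen hp n • (x k - x l) - (x k - x l) =
        (u k - Rfun hp n ⟨u k, huS k⟩) - (u l - Rfun hp n ⟨u l, huS l⟩) := by
      rw [← hzy k, ← hzy l, smul_sub]; abel
    rw [← h2]; exact h1
  have hcauchy : CauchySeq x := by
    have hac : CauchySeq (fun k => u k - Rfun hp n ⟨u k, huS k⟩) := haa.cauchySeq
    rw [Metric.cauchySeq_iff] at hac ⊢
    intro ε hε
    have hC1 : 0 < C + 1 := by linarith
    obtain ⟨N, hN⟩ := hac (ε / (C + 1)) (div_pos hε hC1)
    refine ⟨N, fun k hk l hl => ?_⟩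
    rw [dist_eq_norm]
    have h1 := hest k l
    have h2 := hN k hk l hl
    rw [dist_eq_norm] at h2
    calc ‖x k - x l‖ ≤ C * ‖(u k - Rfun hp n ⟨u k, huS k⟩) - (u l - Rfun hp n ⟨u l, huS l⟩)‖ := h1
      _ ≤ (C + 1) * ‖(u k - Rfun hp n ⟨u k, huS k⟩) - (u l - Rfun hp n ⟨u l, huS l⟩)‖ :=
          mul_le_mul_of_nonneg_right (by linarith) (norm_nonneg _)
      _ < (C + 1) * (ε / (C + 1)) := mul_lt_mul_of_pos_left h2 hC1
      _ = ε := mul_div_cancel₀ ε hC1.ne'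
  obtain ⟨x₀, hx₀⟩ := cauchySeq_tendsto_of_complete hcauchy
  -- (5) the limit `x₀ ∈ X`, `R_n x₀ = 0`, `γ x₀ - x₀ = a`
  have hx₀X : x₀ ∈ X hp :=
    isClosed_closure.mem_of_tendsto hx₀ (Eventually.of_forall fun k => S_subset_X hp (hxS k))
  refine ⟨x₀, hx₀X, ?_, ?_⟩
  · have h1 : Tendsto (fun k => incl hp ⟨x k, hxS k⟩) atTop (𝓝 (⟨x₀, hx₀X⟩ : X hp)) := by
      rw [tendsto_subtype_rng]; exact hx₀
    have h2 := ((continuous_Rhat hp hn).tendsto _).comp h1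
    have h3 : (fun k => Rhat hp n (incl hp ⟨x k, hxS k⟩)) = fun _ => 0 := by
      funext k
      rw [Rhat_incl hp hn]
      obtain hk := hzK k
      have hy : ((z k : NormedAlgClosure F) : CompletedAlgClosure F) = x k := rfl
      rw [Rfun_eq hp (by omega) hy (hMk k) (hzK k), hz0, Completion.coe_zero]
    rw [Function.comp_def, h3] at h2
    exact tendsto_nhds_unique h2 tendsto_const_nhds
  · have h1 : Tendsto (fun k => gen hp n • x k - x k) atTop (𝓝 (gen hp n • x₀ - x₀)) :=
      (((CompletedAlgClosure.continuous_base_smul hp _).tendsto _).comp hx₀).sub hx₀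
    have h2 : (fun k => gen hp n • x k - x k) = fun k => u k - Rfun hp n ⟨u k, huS k⟩ := funext hzy
    rw [h2] at h1
    exact tendsto_nhds_unique h1 haa

/-! ### The `H¹` criterion on `X`: `a ∈ X` is a `γ`-coboundary in `X` iff `R_n a = 0` -/

/-- `X` is closed under negation. [cite: Tate1967, §3.1] -/
theorem neg_mem_X {x : CompletedAlgClosure F} (hx : x ∈ X hp) : -x ∈ X hp := by
  have h := ι_mul_mem_X hp (-1) hx
  rwa [← ιHom_apply, map_neg, map_one, neg_one_mul] at h

/-- `X` is closed under subtraction (a private copy; the public statement is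
`TateTrace.sub_mem_X` of `TateTwistCoboundary`). [folklore] -/
private theorem sub_mem_X' {x a : CompletedAlgClosure F} (hx : x ∈ X hp) (ha : a ∈ X hp) : x - a ∈ X hp := by
  rw [sub_eq_add_neg]; exact add_mem_X hp hx (neg_mem_X hp ha)

/-- **`R_n` kills `γ`-coboundaries of `X`**: `R_n (γ x − x) = 0` for `x ∈ X` (`R_n` is additive and
`R_n ∘ γ = R_n`). [cite: Tate1967, §3.2 Prop. 7] -/
theorem Rhat_gen_smul_sub_self {n : ℕ} (hn : 2 ≤ n) (x : X hp) :
    Rhat hp n ⟨gen hp n • (x : CompletedAlgClosure F) - x, sub_mem_X' hp (smul_mem_X hp _ x.2) x.2⟩ = 0 := by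
  have hneg : -(x : CompletedAlgClosure F) ∈ X hp := neg_mem_X hp x.2
  have h1 : (⟨gen hp n • (x : CompletedAlgClosure F) - x, sub_mem_X' hp (smul_mem_X hp _ x.2) x.2⟩ : X hp) =
      ⟨(genX hp n x : CompletedAlgClosure F) + (⟨-(x : CompletedAlgClosure F), hneg⟩ : X hp),
        add_mem_X hp (genX hp n x).2 hneg⟩ := by
    apply Subtype.ext
    change gen hp n • (x : CompletedAlgClosure F) - x = gen hp n • (x : CompletedAlgClosure F) + -(x : CompletedAlgClosure F)
    rw [sub_eq_add_neg]
  -- `-x = ι(-1) * x`, so `R_n(-x) = -R_n x`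
  have h2 : (⟨-(x : CompletedAlgClosure F), hneg⟩ : X hp) = mulX hp (-1) x := by
    apply Subtype.ext
    change -(x : CompletedAlgClosure F) = ι hp (-1) * x
    rw [← ιHom_apply, map_neg, map_one, neg_one_mul]
  rw [h1, Rhat_add hp hn, Rhat_genX hp hn, h2, Rhat_mulX hp hn, ← ιHom_apply, map_neg, map_one,
    neg_one_mul, add_neg_cancel]

/-- **Injectivity of `γ − 1` on `ker R_n`**: if `x ∈ X`, `R_n x = 0` and `γ x = x`, then `x = 0`
(Tate's estimate `‖x − R_n x‖ ≤ ‖p‖⁻² ‖γ x − x‖`). [cite: Tate1967, §3.2 Prop. 7] -/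
theorem eq_zero_of_Rhat_eq_zero_of_gen_smul_eq {n : ℕ} (hn : 2 ≤ n) (x : X hp) (h0 : Rhat hp n x = 0)
    (hγ : gen hp n • (x : CompletedAlgClosure F) = x) : (x : CompletedAlgClosure F) = 0 := by
  have h := norm_sub_Rhat_le hp hn x
  rw [h0, sub_zero, hγ, sub_self, norm_zero, mul_zero] at h
  exact norm_eq_zero.mp (le_antisymm h (norm_nonneg _))

/-- **Tate's `H¹` criterion on `X = \widehat{K_∞}`** (§3.2 Prop. 7–8): for `a ∈ X`, `a` is a `γ`-coboundary
`γ x − x` of some `x ∈ X` if and only if `R_n a = 0`; the solution can be taken in `ker R_n`, where it is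
unique (`eq_zero_of_Rhat_eq_zero_of_gen_smul_eq`). Hence `H¹(γ^ℤ, X) ≅ X / (γ − 1)X ≅ R_n(X)`, detected by
the normalised trace. [cite: Tate1967, §3.2 Prop. 7] [cite: FontaineOuyang2022, §3.1 Prop. 3.16] -/
theorem exists_gen_smul_sub_eq_iff_Rhat_eq_zero {n : ℕ} (hn : 2 ≤ n) (a : X hp) :
    (∃ x : X hp, gen hp n • (x : CompletedAlgClosure F) - x = a) ↔ Rhat hp n a = 0 := by
  constructor
  · rintro ⟨x, hx⟩
    have h := Rhat_gen_smul_sub_self hp hn x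
    have h1 : (⟨gen hp n • (x : CompletedAlgClosure F) - x, sub_mem_X' hp (smul_mem_X hp _ x.2) x.2⟩ : X hp) = a :=
      Subtype.ext hx
    rwa [h1] at h
  · intro h0
    obtain ⟨x, hx, -, hxa⟩ := exists_gen_smul_sub_eq_of_Rhat_eq_zero hp hn a.2 (by simpa using h0)
    exact ⟨⟨x, hx⟩, hxa⟩


/-! ### `R_n` on `X`: values in `X` and idempotence (by density) -/

/-- `X = \widehat{K_∞}` is closed in `ℂ_F`. [cite: Tate1967, §3.1] -/
theorem isClosed_X : IsClosed (X hp) := isClosed_closure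

/-- **`R_n x ∈ X`** for `x ∈ X` (by density: `R_n s ∈ K n ⊆ K_∞` on `S`). [cite: Tate1967, §3.1] -/
theorem Rhat_mem_X {n : ℕ} (hn : 2 ≤ n) (x : X hp) : Rhat hp n x ∈ X hp := by
  refine isClosed_property (denseRange_incl hp) (p := fun x => Rhat hp n x ∈ X hp)
    ((isClosed_X hp).preimage (continuous_Rhat hp hn)) (fun s => ?_) x
  rw [Rhat_incl hp hn]
  exact S_subset_X hp (Rfun_mem_S hp hn s)

/-- **`R_n` is idempotent on `X`.** [cite: Tate1967, §3.1] -/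
theorem Rhat_Rhat {n : ℕ} (hn : 2 ≤ n) (x : X hp) :
    Rhat hp n ⟨Rhat hp n x, Rhat_mem_X hp hn x⟩ = Rhat hp n x := by
  have hcont : Continuous fun x : X hp => (⟨Rhat hp n x, Rhat_mem_X hp hn x⟩ : X hp) :=
    (continuous_Rhat hp hn).subtype_mk _
  refine isClosed_property (denseRange_incl hp)
    (p := fun x => Rhat hp n ⟨Rhat hp n x, Rhat_mem_X hp hn x⟩ = Rhat hp n x)
    (isClosed_eq ((continuous_Rhat hp hn).comp hcont) (continuous_Rhat hp hn)) (fun s => ?_) x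
  have h1 : (⟨Rhat hp n (incl hp s), Rhat_mem_X hp hn (incl hp s)⟩ : X hp) =
      incl hp ⟨Rfun hp n s, Rfun_mem_S hp hn s⟩ := by
    apply Subtype.ext
    exact Rhat_incl hp hn s
  rw [h1, Rhat_incl hp hn, Rhat_incl hp hn, Rfun_Rfun hp hn]

/-! ### `R_n` is `G₀`-equivariant -/

/-- `R_n` commutes with the action of `G₀` at finite level: `R_n (g • y) = g • R_n y` for `y ∈ K M`
(`G₀` acts on `K M` through an abelian quotient, tree `smul_comm_of_mem_K`). [cite: Tate1967, §3.1] -/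
theorem traceToLevel_base_smul {n M : ℕ} (g : BaseGaloisGroup hp) {y : NormedAlgClosure F} (hy : y ∈ K hp M) :
    traceToLevel hp n M (g • y) = g • traceToLevel hp n M y := by
  rw [traceToLevel_def, traceToLevel_def, avg_def, avg_def]
  have h1 : ∑ k ∈ Finset.range (p ^ (M - n)), gen hp n ^ k • g • y =
      ∑ k ∈ Finset.range (p ^ (M - n)), g • gen hp n ^ k • y :=
    Finset.sum_congr rfl fun k _ => (smul_comm_of_mem_K hp g (gen hp n ^ k) hy).symm
  rw [h1, ← Finset.smul_sum]
  exact (smul_comm g _ _).symm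

/-- `R_n (g • s) = g • R_n s` on `S`. [cite: Tate1967, §3.1] -/
theorem Rfun_base_smul {n : ℕ} (hn : 1 ≤ n) (g : BaseGaloisGroup hp) (s : S hp) :
    Rfun hp n ⟨g • (s : CompletedAlgClosure F), smul_mem_S hp g s.2⟩ = g • Rfun hp n s := by
  obtain ⟨hl, hmem⟩ := lvl_spec hp n s
  have hy : ((g • pre hp s : NormedAlgClosure F) : CompletedAlgClosure F) = g • (s : CompletedAlgClosure F) := by
    rw [← CompletedAlgClosure.base_smul_coe, coe_pre]
  rw [Rfun_eq hp hn hy hl (smul_mem_K hp g hmem), traceToLevel_base_smul hp g hmem,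
    ← CompletedAlgClosure.base_smul_coe]
  rfl

/-- **`R_n` is `G₀`-equivariant on `X`**: `R_n (g • x) = g • R_n x` (by density). [cite: Tate1967, §3.1] -/
theorem Rhat_base_smul {n : ℕ} (hn : 2 ≤ n) (g : BaseGaloisGroup hp) (x : X hp) :
    Rhat hp n ⟨g • (x : CompletedAlgClosure F), smul_mem_X hp g x.2⟩ = g • Rhat hp n x := by
  have hcont : Continuous fun x : X hp => (⟨g • (x : CompletedAlgClosure F), smul_mem_X hp g x.2⟩ : X hp) :=
    ((CompletedAlgClosure.continuous_base_smul hp g).comp continuous_subtype_val).subtype_mk _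
  refine isClosed_property (denseRange_incl hp)
    (p := fun x : X hp => Rhat hp n ⟨g • (x : CompletedAlgClosure F), smul_mem_X hp g x.2⟩ = g • Rhat hp n x)
    (isClosed_eq ((continuous_Rhat hp hn).comp hcont)
      ((CompletedAlgClosure.continuous_base_smul hp g).comp (continuous_Rhat hp hn))) (fun s => ?_) x
  have h1 : (⟨g • ((incl hp s : X hp) : CompletedAlgClosure F), smul_mem_X hp g (incl hp s).2⟩ : X hp) =
      incl hp ⟨g • (s : CompletedAlgClosure F), smul_mem_S hp g s.2⟩ := rfl
  rw [h1, Rhat_incl hp hn, Rhat_incl hp hn, Rfun_base_smul hp (by omega)]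


end TateTrace

end Literature.NumberTheory.PAdicHodge

end
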